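import Literature.Geometry.Riemannian.HamiltonCurvatureODE
import Literature.Geometry.Riemannian.PinchingEstimatesConstraints
import Mathlib.Analysis.SpecialFunctions.Pow.Real
import HarnessLib

/-!
# Route EntropyRung · crux `ChangGurskyYang` — posited objects of the line `margerin-cone-hamilton-rails`
# (Margerin's weak-pinching cone and fundamental polynomial in Hamilton's block coordinates; D-0016 `<Route>Defs` convention)

This file carries no mathematics beyond definitions and their unfolding / symmetry API. It is the
vocabulary over which the six registered stubs of the line `margerin-cone-hamilton-rails` of crux
stmt-SmoothPoincare4-10834 (`Summit.SmoothPoincare4.SmoothPoincare4.Theses.EntropyRung.ChangGurskyYang`,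
= VERBATIM the named fact `Literature.Geometry.Riemannian.changGurskyYang_sphere_four`, CGY 2003 Thm. A)
are stated (skeleton `Cruxes/ChangGurskyYang/Lines/margerin-cone-hamilton-rails.lean`, planner
planner-cruxplan-stmt-SmoothPoincare4-10834-margerin-cone-hamilt-0; lead
prover-line-stmt-SmoothPoincare4-10834-0), moved verbatim out of the crux workfile so that stub proofs
can be landed as `Theorems/…` files (`--supports stmt-SmoothPoincare4-10834`) importing it:

* `frobSq`, `pairing`, `scal`, `rmNormSq`, `devNormSq` — the `(0,4)`-geometry of Hamilton's block
  triples `(A, B, C)` (`HamiltonODE.Blocks`): Frobenius square norm of a block, the pairing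
  `⟨A,A'⟩ + 2⟨B,B'⟩ + ⟨C,C'⟩`, the scalar curvature `R = tr A + tr C`, `|Rm|² = ‖A‖² + 2‖B‖² + ‖C‖²`
  and Margerin's deviation `|𝒟|² = |W|² + 2|E|² = |Rm|² − R²/6`;
* `margerinCone c` — Margerin's closed weak-pinching cone `WP ≤ c` ON THE BIANCHI LOCUS (`A`, `C`
  symmetric, `tr A = tr C`, `R ≥ 0`; the unconstrained typing is kernel-refuted,
  `Cruxes/ChangGurskyYang/TriageR1K3Witness.lean`);
* `margerinP2` — Margerin's fundamental polynomial at `β = 2` along Hamilton's ODE `p' = field p`,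
  `P₂ = R·(|𝒟|²)' − 2|𝒟|²·R' = R³·(WP)'`;
* `pinchingSet m c K τ` — the `β = 2 − τ` pinching sets `margerinCone c ∩ {R ≥ m} ∩ {|𝒟|² ≤ K R^{2−τ}}`.

API: membership unfoldings, invariance of every object under the reflection `B ↦ −B`
(`HamiltonODE.reflectB`, needed to feed the sets to `hamilton_maximumPrinciple_curvatureODE`), the
formula `scal (field p) = (tr A)² + (tr C)² + 2‖B‖²`, and three kernel calibrations (identity ray,
round cylinder `S³ × ℝ` on `∂(45° cone)`, identity ray inside every pinching set). Everything is a
definition or lemma over EXISTING Literature declarations (`HamiltonODE.Blocks`, `HamiltonODE.field`,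
`HamiltonODE.reflectB`, `Matrix.sharp`, `HamiltonODE.trace_field_fst`); nothing restates a route item.
This module deliberately does NOT import the route file `Theses.EntropyRung`.

References: C. Margerin, Comm. Anal. Geom. 6 (1998) 21–65, Part I (p. 25: `|𝒟|² scal⁻²`; Prop. 4,
Lemma 5, Cor. 3, pp. 26–29; Prop. 28, p. 58) [Margerin1998]; R. S. Hamilton, J. Differential Geom. 24
(1986), §5 Def. 5.1 (p. 163), §6 (pp. 165–166) [Hamilton1986]; S.-Y. A. Chang, M. J. Gursky,
P. C. Yang, Publ. Math. IHÉS 98 (2003), (0.2) and Remark 2 [ChangGurskyYang2003].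
-/

noncomputable section

-- every `Summit.SmoothPoincare4.SmoothPoincare4.…` name repeats the summit = sub-problem segment (D-0017 layout)
set_option linter.dupNamespace false

open Set
open scoped Matrix BigOperators

namespace Summit.SmoothPoincare4.SmoothPoincare4.Theorems.MargerinRails

open Literature.Geometry.Riemannian Literature.Geometry.Riemannian.HamiltonODE

/-! ## The `(0,4)`-geometry of block triples -/

/-- Frobenius square norm `Σᵢⱼ Xᵢⱼ²` of a `3 × 3` block. [folklore] -/
def frobSq (X : Matrix (Fin 3) (Fin 3) ℝ) : ℝ := ∑ i, ∑ j, X i j ^ 2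

/-- The `(0,4)`-pairing of block triples `⟨A, A'⟩ + 2⟨B, B'⟩ + ⟨C, C'⟩` (the blocks are the matrix
of `Rm` on bivectors of norm `√2`, so the off-diagonal block counts twice).
[cite: Hamilton1986, §6, p. 165] -/
def pairing (p q : Blocks) : ℝ :=
  (∑ i, ∑ j, p.1 i j * q.1 i j) + 2 * (∑ i, ∑ j, p.2.1 i j * q.2.1 i j) +
    ∑ i, ∑ j, p.2.2 i j * q.2.2 i j

/-- Scalar curvature of a block triple in the tree's normalisation: `R = tr A + tr C`
(unit `S⁴`: `A = C = 2·1`, `R = 12`; unit `S³ × ℝ`: `A = C = 1`, `R = 6`). [cite: Hamilton1986, §6, p. 166] -/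
def scal (p : Blocks) : ℝ := p.1.trace + p.2.2.trace

/-- `|Rm|²` in the `(0,4)`-norm: `‖A‖² + 2‖B‖² + ‖C‖²` (unit `S⁴`: `24 = R²/6`).
[cite: ChangGurskyYang2003, (0.2) and Remark 2] -/
def rmNormSq (p : Blocks) : ℝ := frobSq p.1 + 2 * frobSq p.2.1 + frobSq p.2.2

/-- **Margerin's deviation** `|𝒟|² = |W|² + 2|E|² = |Rm|² − R²/6` — the squared distance of the
block triple to the identity ray `{(λ·1, 0, λ·1)}` in the `(0,4)`-norm (CGY 2003 (0.2): `|Z|²`;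
Margerin 1998, Part I, p. 25). [cite: ChangGurskyYang2003, (0.2)] [cite: Margerin1998, Part I, p. 25] -/
def devNormSq (p : Blocks) : ℝ := rmNormSq p - scal p ^ 2 / 6

/-- **Margerin's closed weak-pinching cone `WP ≤ c`** in Hamilton's block coordinates, ON THE
BIANCHI LOCUS (`A`, `C` symmetric, `tr A = tr C` — load-bearing: off the locus the polynomial
inequality of the line's STUB 1 is kernel-refuted, `Cruxes/ChangGurskyYang/TriageR1K3Witness.lean`),
with `R ≥ 0`: `|𝒟|² ≤ c·R²`. For `c = 1/6` this is the round cone of half-angle `45°` about the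
identity ray; `(ℂP², g_FS)` and `S³ × ℝ` lie on its boundary.
[cite: Margerin1998, Thm. 1 and Part I, p. 25] [cite: ChangGurskyYang2003, (0.2)] -/
def margerinCone (c : ℝ) : Set Blocks :=
  {p | p.1.IsSymm ∧ p.2.2.IsSymm ∧ p.1.trace = p.2.2.trace ∧ 0 ≤ scal p ∧
    devNormSq p ≤ c * scal p ^ 2}

/-- **Margerin's fundamental polynomial at `β = 2`, ODE level**: along Hamilton's ODE
`p' = field p` one has `(|𝒟|²)' = 2⟨p, p'⟩ − R R'/3` and `R' = scal (field p)`, and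
`margerinP2 p = R·(|𝒟|²)' − 2·|𝒟|²·R' = R³ · (WP)'`. Quartic in the 21 block coordinates.
Margerin's `P_β = R·(|𝒟|²)' − β·|𝒟|²·R' = margerinP2 + (2 − β)·|𝒟|²·R'`.
[cite: Margerin1998, Part I, Prop. 4, Lemma 5, Cor. 3 (pp. 26–29) and Prop. 28 (p. 58)] -/
def margerinP2 (p : Blocks) : ℝ :=
  scal p * (2 * pairing p (field p) - scal p * scal (field p) / 3) -
    2 * devNormSq p * scal (field p)

/-- **The `β`-weak-pinching sets** `Z(m, c, K, τ) = margerinCone c ∩ {R ≥ m} ∩ {|𝒟|² ≤ K·R^{2−τ}}`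
(`β = 2 − τ`): Margerin's improving pinching `|𝒟|² ≤ K·scal^β` (Prop. 4) inside the cone `WP ≤ c`,
cut off below by `R ≥ m > 0` so that the sets avoid the apex. Hamilton pinching sets in the sense of
Hamilton 1986, Def. 5.1. [cite: Margerin1998, Part I, Prop. 4 (p. 27)] [cite: Hamilton1986, §5, Def. 5.1 (p. 163)] -/
def pinchingSet (m c K τ : ℝ) : Set Blocks :=
  margerinCone c ∩ {p | m ≤ scal p ∧ devNormSq p ≤ K * scal p ^ (2 - τ)}

/-! ## Unfolding API -/

/-- Membership in Margerin's cone, unfolded. [folklore] -/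
theorem mem_margerinCone {c : ℝ} {p : Blocks} :
    p ∈ margerinCone c ↔ p.1.IsSymm ∧ p.2.2.IsSymm ∧ p.1.trace = p.2.2.trace ∧ 0 ≤ scal p ∧
      devNormSq p ≤ c * scal p ^ 2 := Iff.rfl

/-- Membership in a pinching set, unfolded. [folklore] -/
theorem mem_pinchingSet {m c K τ : ℝ} {p : Blocks} :
    p ∈ pinchingSet m c K τ ↔ p ∈ margerinCone c ∧ m ≤ scal p ∧ devNormSq p ≤ K * scal p ^ (2 - τ) :=
  Iff.rfl

/-- A pinching set lies in its cone. [folklore] -/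
theorem pinchingSet_subset_margerinCone (m c K τ : ℝ) : pinchingSet m c K τ ⊆ margerinCone c :=
  inter_subset_left

/-- `‖X‖_F² ≥ 0`. [folklore] -/
theorem frobSq_nonneg (X : Matrix (Fin 3) (Fin 3) ℝ) : 0 ≤ frobSq X :=
  Finset.sum_nonneg fun _ _ ↦ Finset.sum_nonneg fun _ _ ↦ sq_nonneg _

/-- `‖−X‖_F² = ‖X‖_F²`. [folklore] -/
@[simp] theorem frobSq_neg (X : Matrix (Fin 3) (Fin 3) ℝ) : frobSq (-X) = frobSq X := by
  simp [frobSq]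

/-- `tr (B Bᵀ) = ‖B‖_F²`. [folklore] -/
theorem trace_mul_transpose_self (B : Matrix (Fin 3) (Fin 3) ℝ) : (B * Bᵀ).trace = frobSq B := by
  simp only [Matrix.trace, Matrix.diag_apply, Matrix.mul_apply, Matrix.transpose_apply, frobSq, sq]

/-- **`R' = (tr A)² + (tr C)² + 2‖B‖²` along Hamilton's ODE** (`trace_field_fst`,
`trace_field_snd_snd`); in particular `R' ≥ 0`. [cite: Hamilton1986, §6, p. 166] -/
theorem scal_field (p : Blocks) :
    scal (field p) = p.1.trace ^ 2 + p.2.2.trace ^ 2 + 2 * frobSq p.2.1 := by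
  simp only [scal, trace_field_fst, trace_field_snd_snd, trace_mul_transpose_self]
  ring

/-- `R' ≥ 0` along Hamilton's ODE. [cite: Hamilton1986, §6, p. 166] -/
theorem scal_field_nonneg (p : Blocks) : 0 ≤ scal (field p) := by
  rw [scal_field]
  have := frobSq_nonneg p.2.1
  positivity

/-- `R' ≥ R²/2` along Hamilton's ODE (`(tr A)² + (tr C)² ≥ (tr A + tr C)²/2`). [folklore] -/
theorem half_scal_sq_le_scal_field (p : Blocks) : scal p ^ 2 / 2 ≤ scal (field p) := by
  rw [scal_field, scal]
  nlinarith [frobSq_nonneg p.2.1, sq_nonneg (p.1.trace - p.2.2.trace)]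

/-! ## Symmetry under `B ↦ −B` (the sign convention of the `B^#` term is immaterial) -/

/-- `R` is even in `B`. [folklore] -/
@[simp] theorem scal_reflectB (p : Blocks) : scal (reflectB p) = scal p := rfl

/-- `|Rm|²` is even in `B`. [folklore] -/
@[simp] theorem rmNormSq_reflectB (p : Blocks) : rmNormSq (reflectB p) = rmNormSq p := by
  simp [rmNormSq, reflectB]

/-- `|𝒟|²` is even in `B`. [folklore] -/
@[simp] theorem devNormSq_reflectB (p : Blocks) : devNormSq (reflectB p) = devNormSq p := by
  simp [devNormSq]

/-- Margerin's cone is symmetric under `B ↦ −B`. [folklore] -/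
theorem reflectB_mem_margerinCone {c : ℝ} {p : Blocks} (hp : p ∈ margerinCone c) :
    reflectB p ∈ margerinCone c := by
  obtain ⟨h1, h2, h3, h4, h5⟩ := hp
  exact ⟨h1, h2, h3, by simpa using h4, by simpa using h5⟩

/-- The pinching sets are symmetric under `B ↦ −B`. [folklore] -/
theorem reflectB_mem_pinchingSet {m c K τ : ℝ} {p : Blocks} (hp : p ∈ pinchingSet m c K τ) :
    reflectB p ∈ pinchingSet m c K τ :=
  ⟨reflectB_mem_margerinCone hp.1, by simpa using hp.2.1, by simpa using hp.2.2⟩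

/-! ## Kernel calibrations (cheap guards against mis-normalisation) -/

/-- The deviation vanishes on the identity ray (round `S⁴`: `A = C = λ·1`, `B = 0`). [folklore] -/
theorem devNormSq_idRay (l : ℝ) :
    devNormSq (l • (1 : Matrix (Fin 3) (Fin 3) ℝ), 0, l • (1 : Matrix (Fin 3) (Fin 3) ℝ)) = 0 := by
  simp [devNormSq, rmNormSq, frobSq, scal, Matrix.trace, Matrix.one_apply]
  ring

/-- The round cylinder `S³ × ℝ` (unit `S³`; blocks `(1, 1, 1)` up to the sign of `B`) sits EXACTLY on
the boundary of the `45°` cone: `R = 6`, `|𝒟|² = 6 = R²/6`, `WP = 1/6` (CGY p. 106: Theorem A is sharp).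
[cite: ChangGurskyYang2003, p. 106] -/
theorem devNormSq_cylinder :
    scal ((1 : Matrix (Fin 3) (Fin 3) ℝ), (1 : Matrix (Fin 3) (Fin 3) ℝ), (1 : Matrix (Fin 3) (Fin 3) ℝ)) = 6 ∧
    devNormSq ((1 : Matrix (Fin 3) (Fin 3) ℝ), (1 : Matrix (Fin 3) (Fin 3) ℝ), (1 : Matrix (Fin 3) (Fin 3) ℝ)) = 6 := by
  constructor
  · simp [scal, Matrix.trace]
    norm_num
  · simp [devNormSq, rmNormSq, frobSq, scal, Matrix.trace, Matrix.one_apply]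
    norm_num

/-- The identity ray `(λ·1, 0, λ·1)` with `λ > 0` (the curvature of a round `S⁴`, `R = 6λ`) lies in every
pinching set with `m ≤ 6λ`, `c, K ≥ 0`. [folklore] -/
theorem idRay_mem_pinchingSet : ∀ {m c K τ l : ℝ}, 0 ≤ c → 0 ≤ K → 0 < l → m ≤ 6 * l →
    (l • (1 : Matrix (Fin 3) (Fin 3) ℝ), (0 : Matrix (Fin 3) (Fin 3) ℝ), l • (1 : Matrix (Fin 3) (Fin 3) ℝ)) ∈
      pinchingSet m c K τ := by
  intro m c K τ l hc hK hl hm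
  have hdev := devNormSq_idRay l
  have hscal : scal (l • (1 : Matrix (Fin 3) (Fin 3) ℝ), (0 : Matrix (Fin 3) (Fin 3) ℝ),
      l • (1 : Matrix (Fin 3) (Fin 3) ℝ)) = 6 * l := by
    simp [scal, Matrix.trace]
    ring
  refine ⟨⟨?_, ?_, rfl, ?_, ?_⟩, ?_, ?_⟩
  · exact (Matrix.isSymm_one).smul l
  · exact (Matrix.isSymm_one).smul l
  · rw [hscal]; positivity
  · rw [hdev]; positivity
  · simpa [hscal] using hm
  · rw [hdev]
    exact mul_nonneg hK (Real.rpow_nonneg (by rw [hscal]; positivity) _)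

end Summit.SmoothPoincare4.SmoothPoincare4.Theorems.MargerinRails

end
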